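import Literature.Analysis.FluidPDE.ElgindiL2Coercivity
import HarnessLib

/-!
# The Hardy-type inequality `|L₁₂(f)w|_{L²} ≤ 4|fw|_{L²}` of Elgindi ([Elgindi2021] Lemma 5.4)

Topic `Literature/Analysis/FluidPDE`. Proof file (everything proved, no definitions, no named
facts) on the proof path of the named fact
`Literature.Analysis.FluidPDE.Elgindi.ElgindiGhoulMasmoudi2021_stabilityCore`
(`ElgindiStabilityDecomposition.lean`), continuing `ElgindiL2Coercivity.lean`. T. M. Elgindi,
Ann. of Math. 194 (2021) = arXiv:1904.04795 (`[Elgindi2021]`), §5 **Lemma 5.4** (p. 15 of the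
held text): "Assume `fw ∈ L²` and `L₁₂(f)w ∈ L²`. Then `|L₁₂(f)w|_{L²} ≤ 4|fw|_{L²}`." with
`w = (1+z)²/z²` (Def. 5.2) and `L₁₂(f)(z) = ∫_z^∞∫₀^{π/2} f K/r` — the weighted Hardy inequality
for `L₁₂` used throughout the coercivity and elliptic estimates of [Elgindi2021] §6–§8 ("using
the Hardy inequality and (radialweightonlyL2)") and of Elgindi–Ghoul–Masmoudi, Camb. J. Math. 9
(2021), §3, §6. Printed proof: "We will establish the result for smooth functions with `f` and
`L₁₂(f)` vanishing (at least) quadratically at zero. The general case will follow by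
approximation. Note that `w(z)² = 1/z⁴ + 2/z² + 1`. Thus, it suffices to prove that
`|L₁₂(f)|² ≤ 4|f|²`, `|z⁻¹L₁₂(f)|² ≤ 4|z⁻¹f|²`, `|z⁻²L₁₂(f)|² ≤ 4|z⁻²f|²`. We leave the first two
to the reader and establish the last one. `∫z⁻⁴L₁₂(f)² = |⅓∫∂_z z⁻³ L₁₂(f)²| = |⅔∫z⁻³L₁₂(f)
∂_zL₁₂(f)| = ⅔∫z⁻⁴L₁₂(f)(z)∫₀^{π/2}K(θ)f(z,θ)dθ dz ≤ ⅔|K|_{L²}|z⁻²L₁₂(f)||z⁻²f| < ⅔|z⁻²L₁₂f||z⁻²f|`."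

## What is proved and how (the printed argument, with the actual weight)

The printed identity `w² = z⁻⁴ + 2z⁻² + 1` is that of `(1+z²)/z²`, not of Def. 5.2's
`w = (1+z)²/z²` (for which `w² = 1 + 4/z + 6/z² + 4/z³ + 1/z⁴`); the two weights are comparable
(`(1+z²)/z² ≤ w ≤ 2(1+z²)/z²`) and the printed constant `4` survives. We prove, for the class the
paper proves it on (`f` continuous with compact support inside the open strip — so that
`L₁₂(f)` is `C¹`, `ElgindiL12Calculus.lean` — and `L₁₂(f)(0) = 0`, which is what
"`L₁₂(f)w ∈ L²`" forces):

* the three one-dimensional **Hardy inequalities** for `M ∈ C¹` compactly supported and vanishing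
  near `0`: `∫M² ≤ 4∫z²M'²`, `∫M²/z² ≤ 4∫M'²`, `∫M²/z⁴ ≤ (4/9)∫M'²/z²` (`hardy_sq_le`,
  `hardy_sq_div_sq_le`, `hardy_sq_div_pow_four_le`), each from the by-parts identity
  `∫u'M² = −2∫uMM'` (`integral_deriv_weight_mul_sq`, `u = z, −1/z, −1/(3z³)`) and `2ab ≤ εa² + b²/ε`
  — exactly the printed computation for the last one, the "reader's" two likewise;
* the angular Cauchy–Schwarz step `(∫₀^{π/2}K f dθ)² ≤ |K|²_{L²}∫₀^{π/2}f² dθ`, `|K|²_{L²} = 9π/32`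
  (`sq_kMoment_le`);
* the absorption of the odd powers, `w² ≤ 2 + 11/z² + 5/z⁴` and `1 + 6/z² + 1/z⁴ ≤ w²` (`z > 0`);
* **Lemma 5.4**: `∫₀^∞ (L₁₂(f)w)² dz ≤ (9π/4)∬_strip (fw)² dz dθ ≤ 16∬_strip (fw)²`
  (`integral_sq_L12_mul_radialWeight_le`, `hardyL12`), i.e. `|L₁₂(f)w|_{L²_z} ≤ 4|fw|_{L²(dz dθ)}`
  (the version with the left side in `L²(dz dθ)` of the strip follows with the factor `π/2`,
  `9π²/8 < 16`; not spelled out here).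

Used from Mathlib: `integral_of_hasDerivAt_of_tendsto`, `integral_mono`, `integral_prod`,
`Real.pi_lt_d4`.
-/

noncomputable section

open MeasureTheory Set Function Real Filter
open _root_.Topology

namespace Literature.Analysis.FluidPDE

namespace Elgindi

/-! ### Integration by parts against a weight smooth away from `0` -/

/-- **`∫ u'M² = −2∫ u M M'`** for a weight `u` differentiable away from `0` (with `u`, `u'`
continuous there) and `M ∈ C¹(ℝ)` compactly supported and vanishing on `(−∞, a)`, `a > 0`
(`(uM²)' = u'M² + 2uMM'` integrates to `0`; no boundary terms because `M ≡ 0` near `0` and near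
`∞`). The template of the three integrations by parts of the proof of Lemma 5.4
("`∫z⁻⁴L₁₂(f)² = |⅓∫∂_z z⁻³L₁₂(f)²| = |⅔∫z⁻³L₁₂(f)∂_zL₁₂(f)|`"). [cite: Elgindi2021, §5 Lemma 5.4, proof (p. 15 of arXiv:1904.04795)] -/
theorem integral_deriv_weight_mul_sq {u u' M M' : ℝ → ℝ} (hu : ∀ z, z ≠ 0 → HasDerivAt u (u' z) z)
    (huc : ContinuousOn u {0}ᶜ) (hu'c : ContinuousOn u' {0}ᶜ) (hM : ∀ z, HasDerivAt M (M' z) z)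
    (hM'c : Continuous M') (hMs : HasCompactSupport M) {a : ℝ} (ha : 0 < a)
    (hMa : ∀ z < a, M z = 0) :
    ∫ z, u' z * M z ^ 2 = -2 * ∫ z, u z * (M z * M' z) := by
  have hMc : Continuous M := continuous_iff_continuousAt.2 fun z => (hM z).continuousAt
  have hM0 : ∀ z, z ∉ tsupport M → M z = 0 := fun z hz => image_eq_zero_of_notMem_tsupport hz
  set H : ℝ → ℝ := fun z => u z * M z ^ 2 with hH
  set H' : ℝ → ℝ := fun z => u' z * M z ^ 2 + u z * (2 * M z * M' z) with hH'
  have hHd : ∀ z, HasDerivAt H (H' z) z := by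
    intro z
    rcases lt_or_ge z a with hz | hz
    · have h0 : H =ᶠ[𝓝 z] fun _ => 0 := by
        filter_upwards [Iio_mem_nhds hz] with s hs
        simp [hH, hMa s hs]
      have : H' z = 0 := by simp [hH', hMa z hz]
      rw [this]
      exact (hasDerivAt_const z (0 : ℝ)).congr_of_eventuallyEq h0
    · have hz0 : z ≠ 0 := (ha.trans_le hz).ne'
      exact ((hu z hz0).mul ((hM z).fun_pow 2)).congr_deriv (by simp only [hH']; ring)
  have c1 : Continuous fun z => u' z * M z ^ 2 :=
    continuous_mul_of_eq_zero_lt hu'c (hMc.pow 2) ha fun z hz => by simp [hMa z hz]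
  have c2 : Continuous fun z => u z * (2 * M z * M' z) :=
    continuous_mul_of_eq_zero_lt huc ((continuous_const.mul hMc).mul hM'c) ha fun z hz => by
      simp [hMa z hz]
  have s1 : HasCompactSupport fun z => u' z * M z ^ 2 :=
    HasCompactSupport.intro hMs.isCompact fun z hz => by simp [hM0 z hz]
  have s2 : HasCompactSupport fun z => u z * (2 * M z * M' z) :=
    HasCompactSupport.intro hMs.isCompact fun z hz => by simp [hM0 z hz]
  have i1 : Integrable fun z => u' z * M z ^ 2 := c1.integrable_of_hasCompactSupport s1
  have i2 : Integrable fun z => u z * (2 * M z * M' z) := c2.integrable_of_hasCompactSupport s2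
  have hHs : HasCompactSupport H := HasCompactSupport.intro hMs.isCompact fun z hz => by
    simp [hH, hM0 z hz]
  have hH0 : Tendsto H (cocompact ℝ) (𝓝 0) := hHs.is_zero_at_infty
  have key := integral_of_hasDerivAt_of_tendsto hHd (i1.add i2) (hH0.mono_left atBot_le_cocompact)
    (hH0.mono_left atTop_le_cocompact)
  rw [sub_zero, integral_add i1 i2] at key
  have e : ∫ z, u z * (2 * M z * M' z) = 2 * ∫ z, u z * (M z * M' z) := by
    rw [← integral_const_mul]
    exact integral_congr_ae (Eventually.of_forall fun z => by ring)
  rw [e] at key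
  linarith

/-! ### Three one-dimensional Hardy inequalities -/

section Hardy

variable {M M' : ℝ → ℝ} (hM : ∀ z, HasDerivAt M (M' z) z) (hM'c : Continuous M')
  (hMs : HasCompactSupport M) {a : ℝ} (ha : 0 < a) (hMa : ∀ z < a, M z = 0)

include hM hM'c hMs ha hMa

omit hM'c hMs ha in
/-- `M' ≡ 0` where `M ≡ 0` (below `a`). [folklore] -/
theorem deriv_eq_zero_of_lt {z : ℝ} (hz : z < a) : M' z = 0 := by
  have h0 : M =ᶠ[𝓝 z] fun _ => 0 := by
    filter_upwards [Iio_mem_nhds hz] with s hs using hMa s hs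
  rw [← (hM z).deriv, h0.deriv_eq, deriv_const]

omit hM'c in
/-- Integrability of `u M²`-type products for a weight continuous away from `0`. [folklore] -/
theorem integrable_weight_mul_sq {u : ℝ → ℝ} (huc : ContinuousOn u {0}ᶜ) :
    Integrable fun z => u z * M z ^ 2 := by
  have hMc : Continuous M := continuous_iff_continuousAt.2 fun z => (hM z).continuousAt
  exact (continuous_mul_of_eq_zero_lt huc (hMc.pow 2) ha fun z hz => by
    simp [hMa z hz]).integrable_of_hasCompactSupport
    (HasCompactSupport.intro hMs.isCompact fun z hz => by simp [image_eq_zero_of_notMem_tsupport hz])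

/-- Integrability of `u M'²`-type products for a weight continuous away from `0`. [folklore] -/
theorem integrable_weight_mul_deriv_sq {u : ℝ → ℝ} (huc : ContinuousOn u {0}ᶜ) :
    Integrable fun z => u z * M' z ^ 2 := by
  have hM'0 : ∀ z, z ∉ tsupport M → M' z = 0 := by
    intro z hz
    have h0 : M =ᶠ[𝓝 z] fun _ => 0 := notMem_tsupport_iff_eventuallyEq.1 hz
    rw [← (hM z).deriv, h0.deriv_eq, deriv_const]
  exact (continuous_mul_of_eq_zero_lt huc (hM'c.pow 2) ha fun z hz => by
    simp [deriv_eq_zero_of_lt hM hMa hz]).integrable_of_hasCompactSupport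
    (HasCompactSupport.intro hMs.isCompact fun z hz => by simp [hM'0 z hz])

/-- Integrability of `u M M'`-type products for a weight continuous away from `0`. [folklore] -/
theorem integrable_weight_mul_mul_deriv {u : ℝ → ℝ} (huc : ContinuousOn u {0}ᶜ) :
    Integrable fun z => u z * (M z * M' z) := by
  have hMc : Continuous M := continuous_iff_continuousAt.2 fun z => (hM z).continuousAt
  exact (continuous_mul_of_eq_zero_lt huc (hMc.mul hM'c) ha fun z hz => by
    simp [hMa z hz]).integrable_of_hasCompactSupport
    (HasCompactSupport.intro hMs.isCompact fun z hz => by simp [image_eq_zero_of_notMem_tsupport hz])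

/-- **Hardy, weight `1`**: `∫ M² ≤ 4∫ z²M'²` for `M ∈ C¹_c` vanishing near `0`
(`∫M² = −2∫zMM' ≤ ½∫M² + 2∫z²M'²`; the first inequality "left to the reader" in the proof of
Lemma 5.4, `|L₁₂(f)|² ≤ 4|f|²` once `zM' = −∫K f dθ`). [cite: Elgindi2021, §5 Lemma 5.4, proof (p. 15 of arXiv:1904.04795)] -/
theorem hardy_sq_le : ∫ z, M z ^ 2 ≤ 4 * ∫ z, z ^ 2 * M' z ^ 2 := by
  have hid := integral_deriv_weight_mul_sq (u := fun z => z) (u' := fun _ => 1)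
    (fun z _ => hasDerivAt_id' z) continuousOn_id continuousOn_const hM hM'c hMs ha hMa
  simp only [one_mul] at hid
  have i0 : Integrable fun z => M z ^ 2 := by
    simpa using integrable_weight_mul_sq hM hMs ha hMa (u := fun _ => 1) continuousOn_const
  have i1 : Integrable fun z => z * (M z * M' z) :=
    integrable_weight_mul_mul_deriv hM hM'c hMs ha hMa continuousOn_id
  have i2 : Integrable fun z => z ^ 2 * M' z ^ 2 :=
    integrable_weight_mul_deriv_sq hM hM'c hMs ha hMa (continuousOn_id.pow 2)
  have hb : ∫ z, -2 * (z * (M z * M' z)) ≤ ∫ z, ((1 / 2) * M z ^ 2 + 2 * (z ^ 2 * M' z ^ 2)) := by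
    refine integral_mono (i1.const_mul _) ((i0.const_mul _).add (i2.const_mul _)) fun z => ?_
    nlinarith [sq_nonneg (M z + 2 * (z * M' z))]
  rw [integral_const_mul, integral_add (i0.const_mul _) (i2.const_mul _), integral_const_mul,
    integral_const_mul] at hb
  linarith

/-- **Hardy, weight `z⁻²`**: `∫ M²/z² ≤ 4∫ M'²` for `M ∈ C¹_c` vanishing near `0`
(`∫M²/z² = 2∫MM'/z ≤ ½∫M²/z² + 2∫M'²`; the second "reader's" inequality of the proof of
Lemma 5.4, `|z⁻¹L₁₂(f)|² ≤ 4|z⁻¹f|²`). [cite: Elgindi2021, §5 Lemma 5.4, proof (p. 15 of arXiv:1904.04795)] -/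
theorem hardy_sq_div_sq_le : ∫ z, 1 / z ^ 2 * M z ^ 2 ≤ 4 * ∫ z, M' z ^ 2 := by
  have hu : ∀ z : ℝ, z ≠ 0 → HasDerivAt (fun z : ℝ => -z⁻¹) (1 / z ^ 2) z := fun z hz => by
    simpa [one_div] using (hasDerivAt_inv hz).fun_neg
  have huc : ContinuousOn (fun z : ℝ => -z⁻¹) {0}ᶜ := (continuousOn_inv₀).neg
  have hu'c : ContinuousOn (fun z : ℝ => 1 / z ^ 2) {0}ᶜ :=
    ContinuousOn.div continuousOn_const (continuousOn_id.pow 2) fun z hz => pow_ne_zero 2 hz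
  have hid := integral_deriv_weight_mul_sq hu huc hu'c hM hM'c hMs ha hMa
  have i0 : Integrable fun z => 1 / z ^ 2 * M z ^ 2 := integrable_weight_mul_sq hM hMs ha hMa hu'c
  have i1 : Integrable fun z => -z⁻¹ * (M z * M' z) :=
    integrable_weight_mul_mul_deriv hM hM'c hMs ha hMa huc
  have i2 : Integrable fun z => M' z ^ 2 := by
    simpa using integrable_weight_mul_deriv_sq hM hM'c hMs ha hMa (u := fun _ => 1) continuousOn_const
  have hb : ∫ z, -2 * (-z⁻¹ * (M z * M' z)) ≤ ∫ z, ((1 / 2) * (1 / z ^ 2 * M z ^ 2) + 2 * M' z ^ 2) := by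
    refine integral_mono (i1.const_mul _) ((i0.const_mul _).add (i2.const_mul _)) fun z => ?_
    have : -2 * (-z⁻¹ * (M z * M' z)) = 2 * ((z⁻¹ * M z) * M' z) := by ring
    rw [this]
    have e : 1 / z ^ 2 * M z ^ 2 = (z⁻¹ * M z) ^ 2 := by rw [one_div, ← inv_pow]; ring
    rw [e]
    nlinarith [sq_nonneg (z⁻¹ * M z - 2 * M' z)]
  rw [integral_const_mul, integral_add (i0.const_mul _) (i2.const_mul _), integral_const_mul,
    integral_const_mul] at hb
  linarith

/-- **Hardy, weight `z⁻⁴`**: `∫ M²/z⁴ ≤ (4/9)∫ M'²/z²` for `M ∈ C¹_c` vanishing near `0` — the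
inequality established in print: "`∫z⁻⁴L₁₂(f)² = |⅓∫∂_z z⁻³L₁₂(f)²| = |⅔∫z⁻³L₁₂(f)∂_zL₁₂(f)| …
≤ ⅔|z⁻²L₁₂(f)||z⁻²f|`", here closed by `2ab ≤ (3/2)a² + (2/3)b²`. [cite: Elgindi2021, §5 Lemma 5.4, proof (p. 15 of arXiv:1904.04795)] -/
theorem hardy_sq_div_pow_four_le : ∫ z, 1 / z ^ 4 * M z ^ 2 ≤ (4 / 9) * ∫ z, 1 / z ^ 2 * M' z ^ 2 := by
  have hu : ∀ z : ℝ, z ≠ 0 → HasDerivAt (fun z : ℝ => -(1 / 3) * (z ^ 3)⁻¹) (1 / z ^ 4) z := by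
    intro z hz
    have h3 : HasDerivAt (fun z : ℝ => z ^ 3) (3 * z ^ 2) z := by simpa using hasDerivAt_pow 3 z
    have h := (h3.inv (pow_ne_zero 3 hz)).const_mul (-(1 / 3))
    refine h.congr_deriv ?_
    field_simp
  have huc : ContinuousOn (fun z : ℝ => -(1 / 3) * (z ^ 3)⁻¹) {0}ᶜ :=
    continuousOn_const.mul ((continuousOn_id.pow 3).inv₀ fun z hz => pow_ne_zero 3 hz)
  have hu'c : ContinuousOn (fun z : ℝ => 1 / z ^ 4) {0}ᶜ :=
    ContinuousOn.div continuousOn_const (continuousOn_id.pow 4) fun z hz => pow_ne_zero 4 hz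
  have hu2c : ContinuousOn (fun z : ℝ => 1 / z ^ 2) {0}ᶜ :=
    ContinuousOn.div continuousOn_const (continuousOn_id.pow 2) fun z hz => pow_ne_zero 2 hz
  have hid := integral_deriv_weight_mul_sq hu huc hu'c hM hM'c hMs ha hMa
  have i0 : Integrable fun z => 1 / z ^ 4 * M z ^ 2 := integrable_weight_mul_sq hM hMs ha hMa hu'c
  have i1 : Integrable fun z => -(1 / 3) * (z ^ 3)⁻¹ * (M z * M' z) :=
    integrable_weight_mul_mul_deriv hM hM'c hMs ha hMa huc
  have i2 : Integrable fun z => 1 / z ^ 2 * M' z ^ 2 :=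
    integrable_weight_mul_deriv_sq hM hM'c hMs ha hMa hu2c
  have hb : ∫ z, -2 * (-(1 / 3) * (z ^ 3)⁻¹ * (M z * M' z)) ≤
      ∫ z, ((1 / 2) * (1 / z ^ 4 * M z ^ 2) + (2 / 9) * (1 / z ^ 2 * M' z ^ 2)) := by
    refine integral_mono (i1.const_mul _) ((i0.const_mul _).add (i2.const_mul _)) fun z => ?_
    rcases lt_or_ge z a with hz | hz
    · simp [hMa z hz]
      positivity
    · have hz0 : z ≠ 0 := (ha.trans_le hz).ne'
      have e1 : -2 * (-(1 / 3) * (z ^ 3)⁻¹ * (M z * M' z)) =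
          (2 / 3) * ((M z / z ^ 2) * (M' z / z)) := by field_simp
      have e2 : 1 / z ^ 4 * M z ^ 2 = (M z / z ^ 2) ^ 2 := by field_simp
      have e3 : 1 / z ^ 2 * M' z ^ 2 = (M' z / z) ^ 2 := by field_simp
      rw [e1, e2, e3]
      nlinarith [sq_nonneg ((3 / 2) * (M z / z ^ 2) - M' z / z)]
  rw [integral_const_mul, integral_add (i0.const_mul _) (i2.const_mul _), integral_const_mul,
    integral_const_mul] at hb
  linarith

end Hardy

/-! ### The angular Cauchy–Schwarz step -/

/-- **`(∫₀^{π/2} f(z,θ)K(θ) dθ)² ≤ |K|²_{L²}∫₀^{π/2} f(z,θ)² dθ`**, `|K|²_{L²} = 9π/32`, for `f(z, ·)`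
continuous (the step "`≤ ⅔|K|_{L²}|z⁻²L₁₂(f)||z⁻²f|`" of the proof of Lemma 5.4). [cite: Elgindi2021, §5 Lemma 5.4, proof (p. 15 of arXiv:1904.04795)] -/
theorem sq_kMoment_le {f : ℝ → ℝ → ℝ} (hf : Continuous (uncurry f)) (z : ℝ) :
    kMoment f z ^ 2 ≤ 9 * π / 32 * ∫ θ in Ioo 0 (π / 2), f z θ ^ 2 := by
  have hg : Continuous fun θ => f z θ := hf.comp (continuous_const.prodMk continuous_id)
  have hI : ∀ {g : ℝ → ℝ}, Continuous g → IntegrableOn g (Ioo 0 (π / 2)) := fun hg =>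
    (hg.integrableOn_Icc (a := 0) (b := π / 2)).mono_set Ioo_subset_Icc_self
  have hκ : (0 : ℝ) < 9 * π / 32 := by positivity
  have i1 : IntegrableOn (fun θ => f z θ ^ 2) (Ioo 0 (π / 2)) := hI (hg.pow 2)
  have i2 : IntegrableOn (fun θ => f z θ * kernelK θ) (Ioo 0 (π / 2)) :=
    hI (hg.mul continuous_kernelK)
  have i3 : IntegrableOn (fun θ => kernelK θ ^ 2) (Ioo 0 (π / 2)) := hI (continuous_kernelK.pow 2)
  -- `0 ≤ ∫ (κ f − φ K)² = κ²∫f² − 2κφ·φ + φ²κ`, `κ = |K|² = 9π/32`, `φ = ∫ f K`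
  have hnn : 0 ≤ ∫ θ in Ioo 0 (π / 2), (9 * π / 32 * f z θ - kMoment f z * kernelK θ) ^ 2 :=
    integral_nonneg fun θ => sq_nonneg _
  have hexp : ∫ θ in Ioo 0 (π / 2), (9 * π / 32 * f z θ - kMoment f z * kernelK θ) ^ 2 =
      (9 * π / 32) ^ 2 * (∫ θ in Ioo 0 (π / 2), f z θ ^ 2) -
        2 * (9 * π / 32 * kMoment f z) * kMoment f z + kMoment f z ^ 2 * (9 * π / 32) := by
    have e : ∀ θ, (9 * π / 32 * f z θ - kMoment f z * kernelK θ) ^ 2 =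
        (9 * π / 32) ^ 2 * f z θ ^ 2 - 2 * (9 * π / 32 * kMoment f z) * (f z θ * kernelK θ) +
          kMoment f z ^ 2 * kernelK θ ^ 2 := fun θ => by ring
    simp_rw [e]
    rw [integral_add, integral_sub, MeasureTheory.integral_const_mul,
      MeasureTheory.integral_const_mul, MeasureTheory.integral_const_mul, setIntegral_kernelK_sq,
      ← kMoment_def]
    all_goals first
      | exact (i1.const_mul _).sub (i2.const_mul _)
      | exact i3.const_mul _
      | exact i2.const_mul _
      | exact i1.const_mul _
  rw [hexp] at hnn
  by_contra hlt
  rw [not_le] at hlt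
  nlinarith [hκ, sq_nonneg (kMoment f z), mul_lt_mul_of_pos_left hlt hκ]

/-! ### Lemma 5.4 -/

/-- **`|L₁₂(f)w|²_{L²_z} ≤ (9π/4)|fw|²_{L²(dz dθ)}`** — Elgindi 2021, Lemma 5.4 ("`|L₁₂(f)w|_{L²} ≤
4|fw|_{L²}`") with the constant the printed argument yields for the weight `w = (1+z)²/z²`: for
`f` continuous with compact support inside the open strip and `L₁₂(f)(0) = 0`,
`∫ (L₁₂(f)(z)w(z))² dz ≤ (9π/4)∬_strip (fw)² dz dθ`. Proof: `w² ≤ 2 + 11/z² + 5/z⁴` (AM–GM on the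
odd powers), the three Hardy inequalities with `z(L₁₂f)' = −∫K f dθ`, the angular
Cauchy–Schwarz `(∫K f)² ≤ (9π/32)∫f²`, and `8(1 + 6/z² + 1/z⁴) ≤ 8w²`. [cite: Elgindi2021, §5 Lemma 5.4 (p. 15 of arXiv:1904.04795)] -/
theorem integral_sq_L12_mul_radialWeight_le {f : ℝ → ℝ → ℝ} (hf : Continuous (uncurry f))
    (hs : HasCompactSupport (uncurry f)) (hsub : tsupport (uncurry f) ⊆ strip) (hL0 : L12 f 0 = 0) :
    ∫ z, (L12 f z * radialWeight z) ^ 2 ≤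
      9 * π / 4 * ∫ p in strip, (f p.1 p.2 * radialWeight p.1) ^ 2 := by
  -- the one-variable objects
  obtain ⟨a, b, ha, -, hfab⟩ := exists_radial_bounds' hs hsub
  set L : ℝ → ℝ := L12 f with hLdef
  set ψ : ℝ → ℝ := fun z => kMoment f z / z with hψ
  have hf0 : ∀ p : ℝ × ℝ, p ∉ tsupport (uncurry f) → f p.1 p.2 = 0 := fun p hp =>
    (image_eq_zero_of_notMem_tsupport hp : uncurry f p = 0)
  have hf0' : ∀ p : ℝ × ℝ, p ∉ strip → f p.1 p.2 = 0 := fun p hp => hf0 p fun h => hp (hsub h)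
  have hLa : ∀ z, z < a → L z = 0 := fun z hz =>
    (L12_eq_L12_zero_of_le hf ha hfab hz.le).trans hL0
  have hLb : ∀ z, b < z → L z = 0 := fun z hz => L12_eq_zero_of_le hf ha hfab hz.le
  have hLd : ∀ z, HasDerivAt L (-ψ z) z := hasDerivAt_L12 hf hs hsub
  have hψc : Continuous ψ := continuous_kMoment_div hf ha hfab
  have hLc : Continuous L := continuous_L12 hf hs hsub
  have hLs : HasCompactSupport L := by
    refine HasCompactSupport.intro (isCompact_Icc (a := a) (b := b)) fun z hz => ?_
    rcases not_and_or.1 (fun h => hz ⟨h.1, h.2⟩ : ¬(a ≤ z ∧ z ≤ b)) with h | h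
    · exact hLa z (not_le.1 h)
    · exact hLb z (not_le.1 h)
  have hφ : ∀ z, kMoment f z = z * ψ z := by
    intro z
    by_cases hz : z = 0
    · rw [hz, kMoment_eq_zero_of_not_mem hfab (Or.inl (by simpa using ha))]; simp
    · simp only [hψ]; field_simp
  -- the three Hardy inequalities for `M = L`, `M' = −ψ`
  have H0 := hardy_sq_le hLd hψc.neg hLs ha hLa
  have H2 := hardy_sq_div_sq_le hLd hψc.neg hLs ha hLa
  have H4 := hardy_sq_div_pow_four_le hLd hψc.neg hLs ha hLa
  -- rewrite their right sides in terms of `φ = kMoment f = zψ`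
  have e0 : ∫ z, z ^ 2 * (-ψ z) ^ 2 = ∫ z, kMoment f z ^ 2 :=
    integral_congr_ae (Eventually.of_forall fun z => by beta_reduce; rw [hφ z]; ring)
  have e2 : ∫ z, (-ψ z) ^ 2 = ∫ z, 1 / z ^ 2 * kMoment f z ^ 2 := by
    refine integral_congr_ae (Eventually.of_forall fun z => ?_)
    beta_reduce
    by_cases hz : z = 0
    · have : kMoment f z = 0 := by
        rw [hz]; exact kMoment_eq_zero_of_not_mem hfab (Or.inl (by simpa using ha))
      simp [hψ, hz]
    · rw [hφ z]; field_simp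
  have e4 : ∫ z, 1 / z ^ 2 * (-ψ z) ^ 2 = ∫ z, 1 / z ^ 4 * kMoment f z ^ 2 := by
    refine integral_congr_ae (Eventually.of_forall fun z => ?_)
    beta_reduce
    by_cases hz : z = 0
    · simp [hz]
    · rw [hφ z]; field_simp
  rw [e0] at H0
  rw [e2] at H2
  rw [e4] at H4
  -- pointwise: `(Lw)² ≤ 2L² + 11 L²/z² + 5 L²/z⁴`
  have hu2 : ContinuousOn (fun z : ℝ => 1 / z ^ 2) {0}ᶜ :=
    ContinuousOn.div continuousOn_const (continuousOn_id.pow 2) fun z hz => pow_ne_zero 2 hz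
  have hu4 : ContinuousOn (fun z : ℝ => 1 / z ^ 4) {0}ᶜ :=
    ContinuousOn.div continuousOn_const (continuousOn_id.pow 4) fun z hz => pow_ne_zero 4 hz
  have hw2 : ContinuousOn (fun z : ℝ => radialWeight z ^ 2) {0}ᶜ := by
    unfold radialWeight
    exact (ContinuousOn.div (by fun_prop) (by fun_prop) fun z hz => pow_ne_zero 2 hz).pow 2
  have iL0 : Integrable fun z => L z ^ 2 := by
    simpa using integrable_weight_mul_sq hLd hLs ha hLa (u := fun _ => 1) continuousOn_const
  have iL2 : Integrable fun z => 1 / z ^ 2 * L z ^ 2 := integrable_weight_mul_sq hLd hLs ha hLa hu2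
  have iL4 : Integrable fun z => 1 / z ^ 4 * L z ^ 2 := integrable_weight_mul_sq hLd hLs ha hLa hu4
  have iLw : Integrable fun z => (L z * radialWeight z) ^ 2 := by
    have := integrable_weight_mul_sq hLd hLs ha hLa hw2
    exact this.congr (Eventually.of_forall fun z => by ring)
  have step1 : ∫ z, (L z * radialWeight z) ^ 2 ≤
      ∫ z, (2 * L z ^ 2 + 11 * (1 / z ^ 2 * L z ^ 2) + 5 * (1 / z ^ 4 * L z ^ 2)) := by
    refine integral_mono iLw (((iL0.const_mul _).add (iL2.const_mul _)).add (iL4.const_mul _))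
      fun z => ?_
    rcases lt_or_ge z a with hz | hz
    · simp [hLa z hz]
    · have hz0 : 0 < z := ha.trans_le hz
      have hw : radialWeight z ^ 2 ≤ 2 + 11 * (1 / z ^ 2) + 5 * (1 / z ^ 4) := by
        have hz0' : z ≠ 0 := hz0.ne'
        have e1 : radialWeight z ^ 2 = (1 + z) ^ 4 / z ^ 4 := by
          unfold radialWeight
          rw [div_pow, ← pow_mul, ← pow_mul]
        have e2 : (2 : ℝ) + 11 * (1 / z ^ 2) + 5 * (1 / z ^ 4) = (2 * z ^ 4 + 11 * z ^ 2 + 5) / z ^ 4 := by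
          field_simp
        rw [e1, e2]
        exact div_le_div_of_nonneg_right
          (by nlinarith [sq_nonneg (z ^ 2 - 2 * z), sq_nonneg (z - 2)]) (by positivity)
      calc (L z * radialWeight z) ^ 2 = L z ^ 2 * radialWeight z ^ 2 := by ring
        _ ≤ L z ^ 2 * (2 + 11 * (1 / z ^ 2) + 5 * (1 / z ^ 4)) :=
            mul_le_mul_of_nonneg_left hw (sq_nonneg _)
        _ = _ := by ring
  rw [integral_add, integral_add, integral_const_mul, integral_const_mul, integral_const_mul] at step1
  rotate_left
  · exact iL0.const_mul _
  · exact iL2.const_mul _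
  · exact (iL0.const_mul _).add (iL2.const_mul _)
  · exact iL4.const_mul _
  -- the `θ`-Cauchy–Schwarz `φ² ≤ (9π/32) F2`, `F2(z) = ∫_θ f(z,θ)²`
  set F2 : ℝ → ℝ := fun z => ∫ θ in Ioo 0 (π / 2), f z θ ^ 2 with hF2
  have hK : ∀ z, kMoment f z ^ 2 ≤ 9 * π / 32 * F2 z := fun z => sq_kMoment_le hf z
  have hF2nn : ∀ z, 0 ≤ F2 z := fun z => by
    simp only [hF2]
    exact integral_nonneg fun θ => sq_nonneg _
  have hF20 : ∀ z, z ∉ Icc a b → F2 z = 0 := by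
    intro z hz
    simp only [hF2]
    refine setIntegral_eq_zero_of_forall_eq_zero fun θ _ => ?_
    have : f z θ = 0 := by
      by_contra h
      exact hz ⟨(hfab z θ h).1, (hfab z θ h).2⟩
    simp [this]
  have hF2a : ∀ z, z < a → F2 z = 0 := fun z hz => hF20 z fun h => (not_le.2 hz) h.1
  have hφ0 : ∀ z, z ∉ Icc a b → kMoment f z = 0 := by
    intro z hz
    refine kMoment_eq_zero_of_not_mem hfab ?_
    rcases not_and_or.1 (fun h => hz ⟨h.1, h.2⟩ : ¬(a ≤ z ∧ z ≤ b)) with h | h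
    · exact Or.inl (not_le.1 h)
    · exact Or.inr (not_le.1 h)
  have hφa : ∀ z, z < a → kMoment f z = 0 := fun z hz => hφ0 z fun h => (not_le.2 hz) h.1
  have hF2c : Continuous F2 := by
    have e : F2 = fun z => ∫ θ in Icc 0 (π / 2), f z θ ^ 2 := by
      funext z
      simp only [hF2]
      rw [integral_Icc_eq_integral_Ioo]
    rw [e]
    exact continuous_parametric_integral_of_continuous
      (by fun_prop : Continuous (uncurry fun z θ => f z θ ^ 2)) isCompact_Icc
  have hkc : Continuous (kMoment f) := continuous_kMoment hf
  have iφ : ∀ {u : ℝ → ℝ}, ContinuousOn u {0}ᶜ → Integrable fun z => u z * kMoment f z ^ 2 := by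
    intro u hu
    exact (continuous_mul_of_eq_zero_lt hu (hkc.pow 2) ha fun z hz => by
      simp [hφa z hz]).integrable_of_hasCompactSupport
      (HasCompactSupport.intro (isCompact_Icc : IsCompact (Icc a b)) fun z hz => by simp [hφ0 z hz])
  have iF : ∀ {u : ℝ → ℝ}, ContinuousOn u {0}ᶜ → Integrable fun z => u z * F2 z := by
    intro u hu
    exact (continuous_mul_of_eq_zero_lt hu hF2c ha fun z hz => hF2a z hz).integrable_of_hasCompactSupport
      (HasCompactSupport.intro (isCompact_Icc : IsCompact (Icc a b)) fun z hz => by simp [hF20 z hz])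
  have hcmp : ∀ {u : ℝ → ℝ}, ContinuousOn u {0}ᶜ → (∀ z, 0 ≤ u z) →
      ∫ z, u z * kMoment f z ^ 2 ≤ 9 * π / 32 * ∫ z, u z * F2 z := by
    intro u hu hu0
    rw [← integral_const_mul]
    refine integral_mono (iφ hu) ((iF hu).const_mul _) fun z => ?_
    calc u z * kMoment f z ^ 2 ≤ u z * (9 * π / 32 * F2 z) :=
          mul_le_mul_of_nonneg_left (hK z) (hu0 z)
      _ = 9 * π / 32 * (u z * F2 z) := by ring
  have c0 := hcmp (u := fun _ => (1 : ℝ)) continuousOn_const fun _ => zero_le_one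
  have c2 := hcmp hu2 fun z => by positivity
  have c4 := hcmp hu4 fun z => by positivity
  simp only [one_mul] at c0
  -- `∫ W F2 = ∬_strip W f² ≤ ∬_strip (fw)²`, `W = 1 + 6/z² + 1/z⁴ ≤ w²`
  set W : ℝ → ℝ := fun z => 1 + 6 * (1 / z ^ 2) + 1 / z ^ 4 with hWdef
  have hWc : ContinuousOn W {0}ᶜ := (continuousOn_const.add (continuousOn_const.mul hu2)).add hu4
  have hwon : ContinuousOn (fun p : ℝ × ℝ => radialWeight p.1) strip := by
    unfold radialWeight
    exact ContinuousOn.div (by fun_prop) (by fun_prop) fun p hp => pow_ne_zero 2 (ne_of_gt hp.1)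
  have cWf : Continuous fun p : ℝ × ℝ => W p.1 * f p.1 p.2 ^ 2 :=
    continuous_of_continuousOn_strip (isClosed_tsupport _) hsub
      ((hWc.comp continuousOn_fst fun p hp => (ne_of_gt hp.1 : p.1 ≠ 0)).mul
        (hf.continuousOn.pow 2)) fun p hp => by simp [hf0 p hp]
  have sWf : HasCompactSupport fun p : ℝ × ℝ => W p.1 * f p.1 p.2 ^ 2 :=
    HasCompactSupport.intro hs fun p hp => by simp [hf0 p hp]
  have iWf : Integrable fun p : ℝ × ℝ => W p.1 * f p.1 p.2 ^ 2 := cWf.integrable_of_hasCompactSupport sWf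
  have hiG : IntegrableOn (fun p : ℝ × ℝ => (f p.1 p.2 * radialWeight p.1) ^ 2) strip := by
    have e : (fun p : ℝ × ℝ => (f p.1 p.2 * radialWeight p.1) ^ 2) =
        fun p => f p.1 p.2 * (f p.1 p.2 * radialWeight p.1 ^ 2) := by funext p; ring
    rw [e]
    refine (Continuous.integrable_of_hasCompactSupport ?_ hs.mul_right).integrableOn
    exact continuous_of_continuousOn_strip (isClosed_tsupport _) hsub
      (hf.continuousOn.mul (hf.continuousOn.mul (hwon.pow 2))) fun p hp => by simp [hf0 p hp]
  have hFub : ∫ z, W z * F2 z = ∫ p in strip, W p.1 * f p.1 p.2 ^ 2 := by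
    rw [volume_restrict_strip,
      integral_prod _ (by rw [← volume_restrict_strip]; exact iWf.integrableOn),
      ← setIntegral_eq_integral_of_forall_compl_eq_zero (s := Ioi 0) (fun z hz => by
        rw [hF2a z (lt_of_le_of_lt (not_lt.1 hz) ha), mul_zero])]
    refine integral_congr_ae (Eventually.of_forall fun z => ?_)
    simp only [hF2]
    rw [← integral_const_mul]
  have hmono : ∫ p in strip, W p.1 * f p.1 p.2 ^ 2 ≤ ∫ p in strip, (f p.1 p.2 * radialWeight p.1) ^ 2 := by
    refine setIntegral_mono_on iWf.integrableOn hiG measurableSet_strip fun p hp => ?_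
    have hz0 : (0 : ℝ) < p.1 := hp.1
    have hz0' : p.1 ≠ 0 := hz0.ne'
    have hw : W p.1 ≤ radialWeight p.1 ^ 2 := by
      have e1 : radialWeight p.1 ^ 2 = (1 + p.1) ^ 4 / p.1 ^ 4 := by
        unfold radialWeight
        rw [div_pow, ← pow_mul, ← pow_mul]
      have e2 : W p.1 = (p.1 ^ 4 + 6 * p.1 ^ 2 + 1) / p.1 ^ 4 := by
        simp only [hWdef]
        field_simp
      rw [e1, e2]
      exact div_le_div_of_nonneg_right (by nlinarith [hz0, pow_pos hz0 3]) (by positivity)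
    calc W p.1 * f p.1 p.2 ^ 2 ≤ radialWeight p.1 ^ 2 * f p.1 p.2 ^ 2 :=
          mul_le_mul_of_nonneg_right hw (sq_nonneg _)
      _ = (f p.1 p.2 * radialWeight p.1) ^ 2 := by ring
  have hsum : ∫ z, W z * F2 z =
      (∫ z, F2 z) + 6 * (∫ z, 1 / z ^ 2 * F2 z) + ∫ z, 1 / z ^ 4 * F2 z := by
    have iF0 : Integrable F2 := by simpa using iF (u := fun _ => (1 : ℝ)) continuousOn_const
    have iF2' := iF hu2
    have iF4' := iF hu4
    have e : ∀ z, W z * F2 z = F2 z + 6 * (1 / z ^ 2 * F2 z) + 1 / z ^ 4 * F2 z := fun z => by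
      simp only [hWdef]; ring
    simp_rw [e]
    rw [integral_add, integral_add, integral_const_mul]
    all_goals first
      | exact iF0.add (iF2'.const_mul _)
      | exact iF4'
      | exact iF2'.const_mul _
      | exact iF0
  -- final bookkeeping
  have hY2 : 0 ≤ ∫ z, 1 / z ^ 2 * F2 z :=
    integral_nonneg fun z => mul_nonneg (by positivity) (hF2nn z)
  have hY4 : 0 ≤ ∫ z, 1 / z ^ 4 * F2 z :=
    integral_nonneg fun z => mul_nonneg (by positivity) (hF2nn z)
  have hπY2 : 0 ≤ π * ∫ z, 1 / z ^ 2 * F2 z := mul_nonneg pi_pos.le hY2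
  have hπY4 : 0 ≤ π * ∫ z, 1 / z ^ 4 * F2 z := mul_nonneg pi_pos.le hY4
  have hWπ := mul_le_mul_of_nonneg_left (hFub ▸ hmono) (by positivity : (0 : ℝ) ≤ 9 * π / 32)
  rw [hsum] at hWπ
  nlinarith [step1, H0, H2, H4, c0, c2, c4, hWπ, hπY2, hπY4]

/-- **Lemma 5.4 with the printed constant**: `|L₁₂(f)w|_{L²_z} ≤ 4|fw|_{L²(dz dθ)}`, i.e.
`∫(L₁₂(f)w)² dz ≤ 16∬_strip (fw)²` (`9π/4 < 16`). [cite: Elgindi2021, §5 Lemma 5.4 (p. 15 of arXiv:1904.04795)] -/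
theorem hardyL12 {f : ℝ → ℝ → ℝ} (hf : Continuous (uncurry f)) (hs : HasCompactSupport (uncurry f))
    (hsub : tsupport (uncurry f) ⊆ strip) (hL0 : L12 f 0 = 0) :
    ∫ z, (L12 f z * radialWeight z) ^ 2 ≤ 16 * ∫ p in strip, (f p.1 p.2 * radialWeight p.1) ^ 2 := by
  have h := integral_sq_L12_mul_radialWeight_le hf hs hsub hL0
  have hA : 0 ≤ ∫ p in strip, (f p.1 p.2 * radialWeight p.1) ^ 2 := integral_nonneg fun p => sq_nonneg _
  have hπ := Real.pi_lt_d4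
  nlinarith


end Elgindi

end Literature.Analysis.FluidPDE
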